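import Summits.QuantumFields.YangMills.Theorems.UnitScaleTiltProp8FlatPortHRows34
import HarnessLib

/-!
# Route `UnitScaleTilt`, crux K1 child «MinimiserStabilityRegPr» (stmt-QuantumFields-19200), v8 pillar **P2 `stub_flatOpsCubeSeq`** — THE PORT BRIDGE, file 8:
# **THE `G`-ROWS OF `KernelRowsAt` (`IsFlatGW` + `GtSupLetterG` + `GtLaplaceLetterG`) AT A CHARTED FAMILY FROM lit-balaban's THREE (2.136) MAJORANTS** (shapes of
# `B6Prop26LapKLevelV1.prop26_2136_lap_kLevel_unconditional_pad_V1`: `A·pref·e^{−δ₃d}` for `G`, `A·(len/c′)·e^{−δ₃d}` for `∇_νG`, `A·e^{−δ₃d}` for `ΔG`) — by ONE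
# level-absorbed row sum `Σ_{y′} e^{−δ₃d(y,y′)}·L^{3(j(y)−j(y′))} ≤ L³·c₁` ([Balaban1985Variational] (117)/(165): the (−3)-norm → (115)-norm operator bound of the flat
# propagator at `U = 1`; [Balaban1984PropagatorsII] (2.60)/(2.61))

Cell `ym3-torus` (HUMAN RULING D-0037, YM ladder rung R3), seat `ym3-torus-p1` gen 17.  `--supports stmt-QuantumFields-19200 --as helper`; count-neutral; def-free.

WHAT IS PROVED (sorry-free; axioms standard; no definition).
* §1 `abs_apply_le_sum_blocks` (a block majorant bounds `T` on data with BLOCK-DEPENDENT sizes: `|μ| ≤ B(y(·)) ⇒ |(Tμ)(x)| ≤ Σ_{y′} K(y(x), y′)·B(y′)`, (2.52));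
  `rowSum3_le` (the level-absorbed row sum: `Σ_{y′} e^{−δ₃d}·L^{3j(y)}/L^{3j(y′)} ≤ L³·c₁` from r03's `powL_lgap_le` with `p = 3`, `ε = δ₃/2` and (2.61) at rate `δ₃/2`);
* §2 **`gRows_of_portShapes`**: at the carrier `F = ⟨ℓ+1, hL, m, hm⟩`, a charted family `domT hN D hk` (`k = K − n ≥ 1`), units `c′ = L^{K−n}`, ANY positive weights `w♯`, given the
  three majorants (constant `A ≥ 0`, rate `δ₃ ≥ 0`), the threshold `L³·e^{−(δ₃/2)(R·L·M_h − 1)} ≤ 1` and `Ineq261With c₁ (geomT D) δ₃ ½`: the plain-function propagator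
  `G := onFun (GE (domT hN D hk) c′ w♯)` satisfies `IsFlatGW F n K (domT…) w♯ G`, `GtSupLetterG F n K w G (A·L³·c₁)` and `GtLaplaceLetterG F n K w G (A·L³·c₁)` for every P2 weight
  family `w` — the `G`-conjunct of `FlatOpsFromKernelRows.KernelRowsAt`.
HONEST SCOPE: translation/bookkeeping over landed certificates; NOT a claim about the mass gap.

References: T. Bałaban, CMP **102** (1985) 277–309 [Balaban1985Variational] (115)–(117) p.294–295, (165) p.304; CMP **96** (1984) 223–250 [Balaban1984PropagatorsII] Prop. 2.6 (2.136) p.247,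
(2.52) p.232, Lemma 2.1 (2.60)–(2.61) p.234.
-/

set_option autoImplicit false

noncomputable section

open scoped BigOperators

namespace Summit.QuantumFields.YangMills.Theorems.FlatPortGRows

open Literature.MathematicalPhysics.QuantumFieldTheory.Balaban1983to89
open Literature.MathematicalPhysics.QuantumFieldTheory.BalabanImbrieJaffe1984to88.BIJ85AxialPropagator411 (BondSpace)
open B6MultiLevelBoxOperator (N0)
open B6MultiLevelTorusOperator (TDomains)
open B6Geom246MultiLevelBox (bset)
open B6Geom246MultiLevelTorus (geomT bondT)
open B6GlobalChartV1 (PV toBox blkV1 domT)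
open B6Ineq2133TwoScaleV1 (onFun onFun_apply)
open B6GradLegKLevelV1 (DV DV_apply)
open B6LapLegKLevelV1 (LapV LapV_apply)
open B6RandomWalk (HasMajorant BlockSupp blockPiece blockSupp_blockPiece sum_blockPiece)
open B6Lemma21Repaired (Ineq261With)
open B6Ineq281MultiLevelBox (lgap)
open B6Prop26KLevelSkeletonV1 (pref)
open B6Cor28KLevelV1 (powL_lgap_le)
open B6SectAOperatorsV1 (BondIdx)
open B6SectAVectorModelV1 (GE)
open T3ContinuumYM3Torus (T3Family)
open FlatCubeOpsText (IsLevWeight GtSupLetterG GtLaplaceLetterG)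
open FlatOpsLettersAssembly (IsFlatGW)
open FlatPortDistance (blkV1_level)
open FlatPortHRows12 (cf_ne_zero)
open FlatPortHRows34 (levWeight_eq pref_blkV1)

/-- `1 ≤ 3` (named once; every `domT`/`PV` below carries the same proof term). [folklore] -/
private theorem hd3 : 1 ≤ 2 + 1 := by norm_num

/-! ## §1 Block decomposition with block-dependent sizes; the level-absorbed row sum -/

section Generic

/-- **A BLOCK MAJORANT BOUNDS `T` ON DATA WITH BLOCK-DEPENDENT SIZES** (insert `Σ_{y′}Δ(y′) = I`, (2.52)): `|μ(x′)| ≤ B(y(x′))` for all `x′` gives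
`|(Tμ)(x)| ≤ Σ_{y′} K(y(x), y′)·B(y′)`. [cite: Balaban1984PropagatorsII, (2.51)-(2.52) p.232] -/
theorem abs_apply_le_sum_blocks {g : B6.Geometry} {Xt : Type} (blk : Xt → g.Site) {T : Module.End ℝ (Xt → ℝ)} {K : g.Site → g.Site → ℝ}
    (hT : HasMajorant blk T K) {μ : Xt → ℝ} (B : g.Site → ℝ) (hB : ∀ y, 0 ≤ B y) (hμ : ∀ x, |μ x| ≤ B (blk x)) (x : Xt) :
    |T μ x| ≤ ∑ y', K (blk x) y' * B y' := by
  classical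
  have hpieces : ∀ y', |T (blockPiece blk y' μ) x| ≤ K (blk x) y' * B y' := fun y' =>
    hT y' _ (B y') (blockSupp_blockPiece blk μ y' (B y') (hB y') (fun x' hx' => hx' ▸ hμ x')) x
  calc |T μ x| = |∑ y', T (blockPiece blk y' μ) x| := by
        conv_lhs => rw [← sum_blockPiece blk μ]
        rw [map_sum, Finset.sum_apply]
    _ ≤ ∑ y', |T (blockPiece blk y' μ) x| := Finset.abs_sum_le_sum_abs _ _
    _ ≤ ∑ y', K (blk x) y' * B y' := Finset.sum_le_sum fun y' _ => hpieces y'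

variable {d ℓ Mh k R : ℕ} {P' : Fin (d + 1) → ℕ}

/-- **THE LEVEL-ABSORBED ROW SUM**: `Σ_{y′} e^{−δ₃d(y,y′)}·L^{3j(y)}/L^{3j(y′)} ≤ L³·c₁` — the factor `L^{3(j−j′)} ≤ (L³)^{|j−j′|}` costs `e^{(δ₃/2)d}` by (2.60)
(`powL_lgap_le`, threshold `L³e^{−(δ₃/2)(R·L·M_h−1)} ≤ 1`) and the remaining `e^{−(δ₃/2)d}` sums to `c₁` by (2.61). [cite: Balaban1984PropagatorsII, Lemma 2.1 (2.60)-(2.61) p.234; Balaban1985Variational, (117) p.295] -/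
theorem rowSum3_le (D : TDomains d ℓ Mh k P' R) (hMh : 1 ≤ Mh) (hP : ∀ μ, 1 ≤ P' μ) (hRM1 : 1 ≤ R * ((ℓ + 1) * Mh)) {δ₃ c₁ : ℝ} (hδ₃ : 0 ≤ δ₃)
    (hsmall : ((ℓ : ℝ) + 1) ^ 3 * Real.exp (-(δ₃ / 2 * ((R : ℝ) * (((ℓ : ℝ) + 1) * Mh) - 1))) ≤ 1) (h261 : Ineq261With c₁ (geomT D) δ₃ (1 / 2))
    (y : ↥(bset D.toDomains)) :
    ∑ y' : ↥(bset D.toDomains), Real.exp (-(δ₃ * (geomT D).dist y y')) * ((((ℓ + 1 : ℕ) : ℝ)) ^ y.1.1) ^ 3 / ((((ℓ + 1 : ℕ) : ℝ)) ^ y'.1.1) ^ 3 ≤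
      ((ℓ : ℝ) + 1) ^ 3 * c₁ := by
  have hcast : (((ℓ + 1 : ℕ) : ℝ)) = (ℓ : ℝ) + 1 := by push_cast; ring
  have hL1 : (1 : ℝ) ≤ (ℓ : ℝ) + 1 := by linarith [(Nat.cast_nonneg ℓ : (0 : ℝ) ≤ ℓ)]
  have hL0 : (0 : ℝ) < (ℓ : ℝ) + 1 := by linarith
  have habs := powL_lgap_le D hMh hP hRM1 3 (by positivity : (0 : ℝ) ≤ δ₃ / 2) hsmall
  have hterm : ∀ y' : ↥(bset D.toDomains),
      Real.exp (-(δ₃ * (geomT D).dist y y')) * ((((ℓ + 1 : ℕ) : ℝ)) ^ y.1.1) ^ 3 / ((((ℓ + 1 : ℕ) : ℝ)) ^ y'.1.1) ^ 3 ≤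
        ((ℓ : ℝ) + 1) ^ 3 * Real.exp (-(1 / 2 * δ₃ * (geomT D).dist y y')) := by
    intro y'
    rw [hcast]
    -- `L^{3j}/L^{3j′} ≤ (L³)^{|j−j′|}`
    have hratio : (((ℓ : ℝ) + 1) ^ y.1.1) ^ 3 / (((ℓ : ℝ) + 1) ^ y'.1.1) ^ 3 ≤ (((ℓ : ℝ) + 1) ^ 3) ^ lgap D.toDomains y y' := by
      rw [← pow_mul, ← pow_mul, ← pow_mul, div_le_iff₀ (by positivity), ← pow_add]
      refine pow_le_pow_right₀ hL1 ?_
      unfold lgap; omega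
    have h2 := habs y y'
    have hsplit : Real.exp (-(δ₃ * (geomT D).dist y y')) * Real.exp (δ₃ / 2 * (geomT D).dist y y') = Real.exp (-(1 / 2 * δ₃ * (geomT D).dist y y')) := by
      rw [← Real.exp_add]; congr 1; ring
    calc Real.exp (-(δ₃ * (geomT D).dist y y')) * (((ℓ : ℝ) + 1) ^ y.1.1) ^ 3 / (((ℓ : ℝ) + 1) ^ y'.1.1) ^ 3
        = Real.exp (-(δ₃ * (geomT D).dist y y')) * ((((ℓ : ℝ) + 1) ^ y.1.1) ^ 3 / (((ℓ : ℝ) + 1) ^ y'.1.1) ^ 3) := by ring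
      _ ≤ Real.exp (-(δ₃ * (geomT D).dist y y')) * ((((ℓ : ℝ) + 1) ^ 3) * Real.exp (δ₃ / 2 * (geomT D).dist y y')) :=
          mul_le_mul_of_nonneg_left (hratio.trans h2) (Real.exp_pos _).le
      _ = ((ℓ : ℝ) + 1) ^ 3 * (Real.exp (-(δ₃ * (geomT D).dist y y')) * Real.exp (δ₃ / 2 * (geomT D).dist y y')) := by ring
      _ = ((ℓ : ℝ) + 1) ^ 3 * Real.exp (-(1 / 2 * δ₃ * (geomT D).dist y y')) := by rw [hsplit]
  calc ∑ y', Real.exp (-(δ₃ * (geomT D).dist y y')) * ((((ℓ + 1 : ℕ) : ℝ)) ^ y.1.1) ^ 3 / ((((ℓ + 1 : ℕ) : ℝ)) ^ y'.1.1) ^ 3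
      ≤ ∑ y', ((ℓ : ℝ) + 1) ^ 3 * Real.exp (-(1 / 2 * δ₃ * (geomT D).dist y y')) := Finset.sum_le_sum fun y' _ => hterm y'
    _ = ((ℓ : ℝ) + 1) ^ 3 * ∑ y', Real.exp (-(1 / 2 * δ₃ * (geomT D).dist y y')) := by rw [Finset.mul_sum]
    _ ≤ ((ℓ : ℝ) + 1) ^ 3 * c₁ := mul_le_mul_of_nonneg_left (h261 y) (by positivity)

end Generic

/-! ## §2 The `G`-rows at a charted family -/

section Carrier

variable (ℓ : ℕ) (hL : Odd (ℓ + 1) ∧ 1 < ℓ + 1) (m : ℕ) (hm : 1 ≤ m) (n K : ℕ)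
variable {Mh R : ℕ} {P' : Fin (2 + 1) → ℕ}
variable (hN : ∀ μ, N0 ℓ Mh (K - n) P' μ = (PV 2 ℓ m K hd3 hL).sitesPerDir 0) (D : TDomains 2 ℓ Mh (K - n) P' R) (hk : K - n ≤ m + K)

/-- **THE `G`-ROWS OF `KernelRowsAt` FROM THE THREE (2.136) MAJORANTS.**  For units `c′ = L^{K−n}`, ANY positive weights `w♯`, the plain-function propagator
`G := onFun (GE (domT hN D hk) c′ w♯)` is the pinned genuine propagator (`IsFlatGW`), and the (2.136)₁,₂,₄ majorants (constant `A ≥ 0`, rate `δ₃ ≥ 0`) with the threshold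
`L³e^{−(δ₃/2)(R·L·M_h − 1)} ≤ 1` and (2.61) at rate `δ₃/2` give `GtSupLetterG F n K w G (A·L³·c₁)` and `GtLaplaceLetterG F n K w G (A·L³·c₁)` for every P2 weight family `w`.
[cite: Balaban1984PropagatorsII, Prop. 2.6 (2.136) p.247, (2.52) p.232, Lemma 2.1 (2.60)-(2.61) p.234; Balaban1985Variational, (117) p.295, (165) p.304] -/
theorem gRows_of_portShapes (hMh : 1 ≤ Mh) (hP : ∀ μ, 1 ≤ P' μ) (hRM1 : 1 ≤ R * ((ℓ + 1) * Mh))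
    {ws : BondIdx (domT hN D hk) → ℝ} (hws : ∀ i, 0 < ws i) {A δ₃ c₁ : ℝ} (hA : 0 ≤ A) (hδ₃ : 0 ≤ δ₃)
    (hG : HasMajorant (g := geomT D) (blkV1 hN D) (onFun (GE (domT hN D hk) (cf_ne_zero ℓ n K) hws))
      (fun y y' => A * pref ((((ℓ + 1 : ℕ) : ℝ)) ^ (K - n)) y * Real.exp (-(δ₃ * (geomT D).dist y y'))))
    (hDG : ∀ ν : Fin (2 + 1), HasMajorant (g := geomT D) (blkV1 hN D) (DV ν ((((ℓ + 1 : ℕ) : ℝ)) ^ (K - n)) ∘ₗ onFun (GE (domT hN D hk) (cf_ne_zero ℓ n K) hws))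
      (fun y y' => A * ((geomT D).len y * |(((ℓ + 1 : ℕ) : ℝ)) ^ (K - n)|⁻¹) * Real.exp (-(δ₃ * (geomT D).dist y y'))))
    (hLap : HasMajorant (g := geomT D) (blkV1 hN D) (LapV ((((ℓ + 1 : ℕ) : ℝ)) ^ (K - n)) ∘ₗ onFun (GE (domT hN D hk) (cf_ne_zero ℓ n K) hws))
      (fun y y' => A * Real.exp (-(δ₃ * (geomT D).dist y y'))))
    (hsmall : ((ℓ : ℝ) + 1) ^ 3 * Real.exp (-(δ₃ / 2 * ((R : ℝ) * (((ℓ : ℝ) + 1) * Mh) - 1))) ≤ 1) (h261 : Ineq261With c₁ (geomT D) δ₃ (1 / 2))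
    (w : ℕ → PBond (PV 2 ℓ m K hd3 hL) 0 → ℝ) (hw : IsLevWeight (⟨ℓ + 1, hL, m, hm⟩ : T3Family) n K (domT hN D hk) w) :
    IsFlatGW (⟨ℓ + 1, hL, m, hm⟩ : T3Family) n K (domT hN D hk) hws (onFun (GE (domT hN D hk) (cf_ne_zero ℓ n K) hws)) ∧
      GtSupLetterG (⟨ℓ + 1, hL, m, hm⟩ : T3Family) n K w (onFun (GE (domT hN D hk) (cf_ne_zero ℓ n K) hws)) (A * ((ℓ : ℝ) + 1) ^ 3 * c₁) ∧
      GtLaplaceLetterG (⟨ℓ + 1, hL, m, hm⟩ : T3Family) n K w (onFun (GE (domT hN D hk) (cf_ne_zero ℓ n K) hws)) (A * ((ℓ : ℝ) + 1) ^ 3 * c₁) := by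
  -- notation
  set cf : ℝ := (((ℓ + 1 : ℕ) : ℝ)) ^ (K - n) with hcf
  set G := onFun (GE (domT hN D hk) (cf_ne_zero ℓ n K) hws) with hGdef
  have hL0 : (0 : ℝ) < ((ℓ + 1 : ℕ) : ℝ) := by exact_mod_cast Nat.succ_pos ℓ
  have hL1 : (1 : ℝ) ≤ ((ℓ + 1 : ℕ) : ℝ) := by exact_mod_cast Nat.succ_le_succ (Nat.zero_le ℓ)
  have hcast : (((ℓ + 1 : ℕ) : ℝ)) = (ℓ : ℝ) + 1 := by push_cast; ring
  have hcf0 : 0 < cf := pow_pos hL0 _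
  have hFL : ((((⟨ℓ + 1, hL, m, hm⟩ : T3Family).L : ℕ) : ℝ)) = ((ℓ + 1 : ℕ) : ℝ) := rfl
  -- the level of a fine bond and its powers
  have hLj : ∀ b : PBond (PV 2 ℓ m K hd3 hL) 0, (0 : ℝ) < (((ℓ + 1 : ℕ) : ℝ)) ^ D.lev (toBox hN b.src : Fin (2 + 1) → ℤ) := fun b => pow_pos hL0 _
  have hLjcf : ∀ b : PBond (PV 2 ℓ m K hd3 hL) 0, (((ℓ + 1 : ℕ) : ℝ)) ^ D.lev (toBox hN b.src : Fin (2 + 1) → ℤ) ≤ cf :=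
    fun b => pow_le_pow_right₀ hL1 (D.lev_le _)
  -- the data sizes per block: `w₃(b′)|f(b′)| ≤ β ⇒ |f(b′)| ≤ β·(c′/L^{j(b′)})³`
  have hdata : ∀ {f : PBond (PV 2 ℓ m K hd3 hL) 0 → ℝ} {β : ℝ}, 0 ≤ β → (∀ b, w 3 b * |f b| ≤ β) →
      ∀ b', |f b'| ≤ (fun y' : ↥(bset D.toDomains) => β * (cf / (((ℓ + 1 : ℕ) : ℝ)) ^ y'.1.1) ^ 3) (blkV1 hN D b') := by
    intro f β hβ hf b'
    have hw3 : w 3 b' = ((((ℓ + 1 : ℕ) : ℝ)) ^ D.lev (toBox hN b'.src : Fin (2 + 1) → ℤ) / cf) ^ 3 := levWeight_eq ℓ hL m hm n K hN D hk hw 3 b'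
    have hq : 0 < ((((ℓ + 1 : ℕ) : ℝ)) ^ D.lev (toBox hN b'.src : Fin (2 + 1) → ℤ) / cf) ^ 3 := by positivity
    have h1 := hf b'
    rw [hw3] at h1
    show |f b'| ≤ β * (cf / (((ℓ + 1 : ℕ) : ℝ)) ^ D.lev (toBox hN b'.src : Fin (2 + 1) → ℤ)) ^ 3
    rw [← le_div_iff₀' hq] at h1
    refine h1.trans (le_of_eq ?_)
    rw [div_pow, div_pow, div_div_eq_mul_div, mul_div_assoc]
  -- the common row sum, per fine bond `b`
  have hrow : ∀ b : PBond (PV 2 ℓ m K hd3 hL) 0,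
      ∑ y' : ↥(bset D.toDomains), Real.exp (-(δ₃ * (geomT D).dist (blkV1 hN D b) y')) *
          ((((ℓ + 1 : ℕ) : ℝ)) ^ D.lev (toBox hN b.src : Fin (2 + 1) → ℤ)) ^ 3 / ((((ℓ + 1 : ℕ) : ℝ)) ^ y'.1.1) ^ 3 ≤ ((ℓ : ℝ) + 1) ^ 3 * c₁ :=
    fun b => rowSum3_le D hMh hP hRM1 hδ₃ hsmall h261 (blkV1 hN D b)
  -- the three bounds share the computation `(L^j/c′)³·Σ K·B = A·β·Σ e^{−δd}L^{3j}/L^{3j′}`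
  have hkey : ∀ {f : PBond (PV 2 ℓ m K hd3 hL) 0 → ℝ} {β : ℝ}, 0 ≤ β → (∀ b, w 3 b * |f b| ≤ β) → ∀ (b : PBond (PV 2 ℓ m K hd3 hL) 0) (p : ℕ), p ≤ 3 →
      ∀ {T : Module.End ℝ (PBond (PV 2 ℓ m K hd3 hL) 0 → ℝ)},
      HasMajorant (g := geomT D) (blkV1 hN D) T (fun y y' => A * ((((ℓ + 1 : ℕ) : ℝ)) ^ y.1.1 / cf) ^ p * Real.exp (-(δ₃ * (geomT D).dist y y'))) →
      ((((ℓ + 1 : ℕ) : ℝ)) ^ D.lev (toBox hN b.src : Fin (2 + 1) → ℤ) / cf) ^ (3 - p) * |T f b| ≤ A * ((ℓ : ℝ) + 1) ^ 3 * c₁ * β := by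
    intro f β hβ hf b p hp T hT
    have h0 := abs_apply_le_sum_blocks (g := geomT D) (blkV1 hN D) hT (fun y' : ↥(bset D.toDomains) => β * (cf / (((ℓ + 1 : ℕ) : ℝ)) ^ y'.1.1) ^ 3)
      (fun y' => by positivity) (hdata hβ hf) b
    have hlev : (blkV1 hN D b).1.1 = D.lev (toBox hN b.src : Fin (2 + 1) → ℤ) := rfl
    simp only [hlev] at h0
    have hLj0 : 0 < (((ℓ + 1 : ℕ) : ℝ)) ^ D.lev (toBox hN b.src : Fin (2 + 1) → ℤ) := hLj b
    refine (mul_le_mul_of_nonneg_left h0 (by positivity)).trans ?_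
    rw [Finset.mul_sum]
    -- termwise: `(Lj/cf)^{3−p}·(A(Lj/cf)^p e^{−δd})·β(cf/Lj′)³ = Aβ·e^{−δd}·Lj³/Lj′³`
    have hterm : ∀ y' : ↥(bset D.toDomains),
        ((((ℓ + 1 : ℕ) : ℝ)) ^ D.lev (toBox hN b.src : Fin (2 + 1) → ℤ) / cf) ^ (3 - p) *
            (A * ((((ℓ + 1 : ℕ) : ℝ)) ^ D.lev (toBox hN b.src : Fin (2 + 1) → ℤ) / cf) ^ p * Real.exp (-(δ₃ * (geomT D).dist (blkV1 hN D b) y')) *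
              (β * (cf / (((ℓ + 1 : ℕ) : ℝ)) ^ y'.1.1) ^ 3)) =
          A * β * (Real.exp (-(δ₃ * (geomT D).dist (blkV1 hN D b) y')) *
            ((((ℓ + 1 : ℕ) : ℝ)) ^ D.lev (toBox hN b.src : Fin (2 + 1) → ℤ)) ^ 3 / ((((ℓ + 1 : ℕ) : ℝ)) ^ y'.1.1) ^ 3) := by
      intro y'
      have hy0 : (((ℓ + 1 : ℕ) : ℝ)) ^ y'.1.1 ≠ 0 := pow_ne_zero _ hL0.ne'
      have hc : cf ≠ 0 := hcf0.ne'
      have hpow : ((((ℓ + 1 : ℕ) : ℝ)) ^ D.lev (toBox hN b.src : Fin (2 + 1) → ℤ) / cf) ^ (3 - p) *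
          ((((ℓ + 1 : ℕ) : ℝ)) ^ D.lev (toBox hN b.src : Fin (2 + 1) → ℤ) / cf) ^ p =
          ((((ℓ + 1 : ℕ) : ℝ)) ^ D.lev (toBox hN b.src : Fin (2 + 1) → ℤ) / cf) ^ 3 := by rw [← pow_add, Nat.sub_add_cancel hp]
      calc ((((ℓ + 1 : ℕ) : ℝ)) ^ D.lev (toBox hN b.src : Fin (2 + 1) → ℤ) / cf) ^ (3 - p) *
            (A * ((((ℓ + 1 : ℕ) : ℝ)) ^ D.lev (toBox hN b.src : Fin (2 + 1) → ℤ) / cf) ^ p * Real.exp (-(δ₃ * (geomT D).dist (blkV1 hN D b) y')) *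
              (β * (cf / (((ℓ + 1 : ℕ) : ℝ)) ^ y'.1.1) ^ 3))
          = A * β * Real.exp (-(δ₃ * (geomT D).dist (blkV1 hN D b) y')) *
              ((((((ℓ + 1 : ℕ) : ℝ)) ^ D.lev (toBox hN b.src : Fin (2 + 1) → ℤ) / cf) ^ (3 - p) *
                ((((ℓ + 1 : ℕ) : ℝ)) ^ D.lev (toBox hN b.src : Fin (2 + 1) → ℤ) / cf) ^ p) * (cf / (((ℓ + 1 : ℕ) : ℝ)) ^ y'.1.1) ^ 3) := by ring
        _ = A * β * Real.exp (-(δ₃ * (geomT D).dist (blkV1 hN D b) y')) *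
              (((((ℓ + 1 : ℕ) : ℝ)) ^ D.lev (toBox hN b.src : Fin (2 + 1) → ℤ) / cf) ^ 3 * (cf / (((ℓ + 1 : ℕ) : ℝ)) ^ y'.1.1) ^ 3) := by rw [hpow]
        _ = _ := by field_simp
    refine (Finset.sum_le_sum fun y' _ => (hterm y').le).trans ?_
    rw [← Finset.mul_sum]
    calc A * β * ∑ y', Real.exp (-(δ₃ * (geomT D).dist (blkV1 hN D b) y')) *
          ((((ℓ + 1 : ℕ) : ℝ)) ^ D.lev (toBox hN b.src : Fin (2 + 1) → ℤ)) ^ 3 / ((((ℓ + 1 : ℕ) : ℝ)) ^ y'.1.1) ^ 3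
        ≤ A * β * (((ℓ : ℝ) + 1) ^ 3 * c₁) := mul_le_mul_of_nonneg_left (hrow b) (by positivity)
      _ = A * ((ℓ : ℝ) + 1) ^ 3 * c₁ * β := by ring
  refine ⟨fun f b => rfl, ?_, ?_⟩
  · -- `GtSupLetterG`: the sup row (`p = 2`) and the gradient row (`p = 1` after reading `len/|c′|`)
    intro f β hβ hf
    refine ⟨fun b => ?_, fun b ν => ?_⟩
    · have hw1 : w 1 b = ((((ℓ + 1 : ℕ) : ℝ)) ^ D.lev (toBox hN b.src : Fin (2 + 1) → ℤ) / cf) ^ 1 := levWeight_eq ℓ hL m hm n K hN D hk hw 1 b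
      have hG' : HasMajorant (g := geomT D) (blkV1 hN D) G (fun y y' => A * ((((ℓ + 1 : ℕ) : ℝ)) ^ y.1.1 / cf) ^ 2 * Real.exp (-(δ₃ * (geomT D).dist y y'))) := hG
      have h1 := hkey hβ hf b 2 (by norm_num) hG'
      rw [hw1]
      exact h1
    · have hw2 : w 2 b = ((((ℓ + 1 : ℕ) : ℝ)) ^ D.lev (toBox hN b.src : Fin (2 + 1) → ℤ) / cf) ^ 2 := levWeight_eq ℓ hL m hm n K hN D hk hw 2 b
      -- the gradient majorant in the `(L^j/c′)^1` form
      have hDG' : HasMajorant (g := geomT D) (blkV1 hN D) (DV ν cf ∘ₗ G) (fun y y' => A * ((((ℓ + 1 : ℕ) : ℝ)) ^ y.1.1 / cf) ^ 1 * Real.exp (-(δ₃ * (geomT D).dist y y'))) := by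
        intro y' μ B hB x
        have h := hDG ν y' μ B hB x
        dsimp only at h
        have hlen : (geomT D).len (blkV1 hN D x) * |cf|⁻¹ = ((((ℓ + 1 : ℕ) : ℝ)) ^ (blkV1 hN D x).1.1 / cf) ^ 1 := by
          rw [pow_one, abs_of_pos hcf0, div_eq_mul_inv]
          congr 1
          show ((ℓ : ℝ) + 1) ^ (blkV1 hN D x).1.1 * 1 = _
          rw [mul_one, hcast]
        rw [hlen] at h
        exact h
      have h1 := hkey hβ hf b 1 (by norm_num) hDG'
      rw [LinearMap.comp_apply, DV_apply, abs_mul, abs_of_pos hcf0] at h1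
      rw [hw2]
      change ((((ℓ + 1 : ℕ) : ℝ)) ^ D.lev (toBox hN b.src : Fin (2 + 1) → ℤ) / cf) ^ 2 * cf * |G f ⟨b.src.shift ν, b.dir⟩ - G f b| ≤ A * ((ℓ : ℝ) + 1) ^ 3 * c₁ * β
      calc ((((ℓ + 1 : ℕ) : ℝ)) ^ D.lev (toBox hN b.src : Fin (2 + 1) → ℤ) / cf) ^ 2 * cf * |G f ⟨b.src.shift ν, b.dir⟩ - G f b|
          = ((((ℓ + 1 : ℕ) : ℝ)) ^ D.lev (toBox hN b.src : Fin (2 + 1) → ℤ) / cf) ^ (3 - 1) * (cf * |G f ⟨b.src.shift ν, b.dir⟩ - G f b|) := by ring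
        _ ≤ A * ((ℓ : ℝ) + 1) ^ 3 * c₁ * β := h1
  · -- `GtLaplaceLetterG` (`p = 0`)
    intro f β hβ hf b
    have hw3 : w 3 b = ((((ℓ + 1 : ℕ) : ℝ)) ^ D.lev (toBox hN b.src : Fin (2 + 1) → ℤ) / cf) ^ 3 := levWeight_eq ℓ hL m hm n K hN D hk hw 3 b
    have hLap' : HasMajorant (g := geomT D) (blkV1 hN D) (LapV cf ∘ₗ G) (fun y y' => A * ((((ℓ + 1 : ℕ) : ℝ)) ^ y.1.1 / cf) ^ 0 * Real.exp (-(δ₃ * (geomT D).dist y y'))) := by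
      intro y' μ B hB x
      have h := hLap y' μ B hB x
      dsimp only at h ⊢
      rw [pow_zero, mul_one]
      exact h
    have h1 := hkey hβ hf b 0 (by norm_num) hLap'
    rw [LinearMap.comp_apply, LapV_apply, abs_mul, abs_of_pos (pow_pos hcf0 2)] at h1
    have hst : ∑ ν : Fin (2 + 1), ((G f b - G f ⟨b.src.shift ν, b.dir⟩) + (G f b - G f ⟨b.src.unshift ν, b.dir⟩)) =
        ∑ ν : Fin (2 + 1), (2 * G f b - G f ⟨b.src.unshift ν, b.dir⟩ - G f ⟨b.src.shift ν, b.dir⟩) :=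
      Finset.sum_congr rfl fun ν _ => by ring
    rw [hw3]
    change ((((ℓ + 1 : ℕ) : ℝ)) ^ D.lev (toBox hN b.src : Fin (2 + 1) → ℤ) / cf) ^ 3 * cf ^ 2 *
        |∑ ν : Fin (2 + 1), ((G f b - G f ⟨b.src.shift ν, b.dir⟩) + (G f b - G f ⟨b.src.unshift ν, b.dir⟩))| ≤ A * ((ℓ : ℝ) + 1) ^ 3 * c₁ * β
    rw [hst]
    calc ((((ℓ + 1 : ℕ) : ℝ)) ^ D.lev (toBox hN b.src : Fin (2 + 1) → ℤ) / cf) ^ 3 * cf ^ 2 *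
          |∑ ν : Fin (2 + 1), (2 * G f b - G f ⟨b.src.unshift ν, b.dir⟩ - G f ⟨b.src.shift ν, b.dir⟩)|
        = ((((ℓ + 1 : ℕ) : ℝ)) ^ D.lev (toBox hN b.src : Fin (2 + 1) → ℤ) / cf) ^ (3 - 0) *
          (cf ^ 2 * |∑ ν : Fin (2 + 1), (2 * G f b - G f ⟨b.src.unshift ν, b.dir⟩ - G f ⟨b.src.shift ν, b.dir⟩)|) := by ring
      _ ≤ A * ((ℓ : ℝ) + 1) ^ 3 * c₁ * β := h1

end Carrier

end Summit.QuantumFields.YangMills.Theorems.FlatPortGRows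

end
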